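import Mathlib
import HarnessLib
import Literature.Analysis.FluidPDE.VectorCalculus
import Literature.Analysis.FluidPDE.VorticityCalculus
import Literature.Analysis.FluidPDE.Vorticity
import Literature.Analysis.FluidPDE.ClassicalSolution
import Literature.Analysis.FluidPDE.BiotSavartCurlPair
import Literature.Analysis.FluidPDE.BiotSavartNewtonKernel
import Summits.NavierStokesRegularity.NavierStokesRegularity.Theorems.UnthreadedDoorAntidynamoLambAlgebra

/-!
# Route `UnthreadedDoor` / `ThreadingFlux`, crux `PoloidalLiouville` (stmt-NavierStokesRegularity-1222), antidynamo v2 skeleton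
# (sha16 `4ebf5683127b`), WALL `stub_scalarLiouville`: THE WALL IS FALSE WITHOUT ITS GROWTH HYPOTHESES (Hill's spherical-vortex core)

Support file (seat leafhand-ns-unthreadeddoor-3 g34, cell decomp-ns), `--supports stmt-NavierStokesRegularity-1222 --as helper`;
theorems only, no definitions, no named facts.

`StubScalarLiouville` (the wall; kernel-equivalent to the crux by `stubScalarLiouville_iff_poloidalLiouville'`) carries seven hypotheses:
(1) `IsBoundedAncientMildSolution 1 v`, (2) measurable slices, (3) joint smoothness of `v` on the open past slab, (4) joint smoothness of the
toroidal potential `T` off the centre, (5) `T` bounded, (6) the representation `curl v(t) = ∇T(t) × (x − x₀)`, (7) the evolution law (E1)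
`∇(∂ₜT + ⟪v, ∇T⟫ − ΔT) × (x − x₀) = ∇⟪v, x − x₀⟫ × ∇T` (which, GIVEN (6), is the vorticity equation — `stub_potentialEvolution`).
This file records, kernel-checked, that **hypotheses (2), (3), (4), (6), (7) — even together with the classical Navier–Stokes VORTICITY
FORMULATION `IsVorticitySolutionOn (−∞,0) 1 v` (what the bridge stub `stub_vorticityOfClass` extracts from (1), minus its curl bound) — do
NOT imply the conclusion `∇T × (x − x₀) ≡ 0`** (`stubScalarLiouville_false_without_bounds_vorticityClass`, and the weaker
`stubScalarLiouville_false_without_bounds`): the two GROWTH hypotheses hidden in (1)/(5) (boundedness of `v`, of `T`) are load-bearing for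
every proof of the wall.

WITNESS (`stubScalarLiouville_false_without_bounds`).  Fix a unit vector `e`.  The steady field
`v(z) = ⟪e, z⟫ z − 2‖z‖² e` with `T(z) = 5⟪e, z⟫`, centre `x₀ = 0`, satisfies `curl v = 5 e × z = ∇T × z` (`curl_hillCore`), and both sides of
(E1) equal `10⟪e, z⟫ • (e × z)` (`hillCore_E1_lhs`, `hillCore_E1_rhs`); but `∇T × z = 5 e × z ≠ 0` off the axis.  In coordinates with
`e = e₃` this is `v = (xz, yz, −2(x² + y²) − z²)`, i.e. EXACTLY the rotational core of Hill's spherical vortex with `c = 5`, `a = 0`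
(`Literature.Analysis.FluidPDE.hillCoreU/V/W`; `hill_core_div`, `hill_core_vorticity`, `hill_core_euler_x/y/z` certify there that it is a
divergence-free steady Euler flow with polynomial pressure).  §2b proves DIRECTLY, coordinate-free, that the witness is a classical solution
of the vorticity formulation on `(−∞,0)` with `ν = 1` (`isVorticitySolutionOn_hillCore`: `div v = 0`, `ω = 5 e × z`, `∂ₜω = 0`,
`(v·∇)ω = (ω·∇)v = 5⟪e,z⟫ (e × z)`, `Δω = 0`), i.e. a steady — hence ancient — smooth Navier–Stokes flow in the vorticity sense.  So the
witness is a genuine unthreaded (purely poloidal) smooth ancient flow violating only boundedness: `|v(z)| ~ ‖z‖²`, `|T(z)| ~ ‖z‖`.  READING /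
a future (2b) line: the KNSS-type endgame «`ω_φ = η ϖ` with `η` constant is unbounded unless `η = 0`» (arXiv:0709.3599 p. 11) is exactly what
removes this witness (`η = T_c / R ≡ 5` here); no maximum-principle scalar ALONE closes the wall.

APPEND v2 (§4, same seat): the same witness refutes the CRUX'S OWN SHAPE without boundedness (`poloidalLiouville_shape_false_without_bounds`:
`IsBoundedAncientMildSolution` ↦ `IsVorticitySolutionOn`, unthreaded about `0`, slices not constant).

HONEST LABEL: a tightness / idle-hypothesis certificate for the open wall; it closes no stub, does not touch `PoloidalLiouville` (1222) or
the flat-direction Liouville problem, and nothing here bears on Navier–Stokes regularity; no summit statement is proved.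
[cite: Hill1894; Acheson1990, §5.5 eq. (5.25); KochNadirashviliSereginSverak2009, Thm 5.2 (arXiv:0709.3599 p. 11)]
-/

noncomputable section

-- the summit and its single sub-problem share the name (CONVENTIONS §1)
set_option linter.dupNamespace false

open scoped Topology InnerProductSpace RealInnerProductSpace ContDiff
open Filter Set Function Metric MeasureTheory
open Literature.Analysis.FluidPDE

namespace Summit.NavierStokesRegularity.NavierStokesRegularity.Theorems.PoloidalLiouville.Antidynamo

/-! ### §1 Gradients of the explicit scalars -/

/-- Bridge: a Fréchet derivative of the form `h ↦ ⟪g, h⟫` identifies the gradient as `g`. [folklore] -/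
theorem gradient_eq_of_hasFDerivAt_inner {f : (EuclideanSpace ℝ (Fin 3)) → ℝ} {x g : (EuclideanSpace ℝ (Fin 3))} {L : (EuclideanSpace ℝ (Fin 3)) →L[ℝ] ℝ}
    (h : HasFDerivAt f L x) (hL : ∀ y, L y = ⟪g, y⟫) : gradient f x = g := by
  have hL' : L = InnerProductSpace.toDual ℝ (EuclideanSpace ℝ (Fin 3)) g :=
    ContinuousLinearMap.ext fun y => by rw [InnerProductSpace.toDual_apply_apply, hL y]
  have hg : HasGradientAt f g x := by
    rw [hasGradientAt_iff_hasFDerivAt, ← hL']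
    exact h
  exact hg.gradient

/-- `∇(5⟪e, ·⟫) = 5 e`. [folklore] -/
theorem gradient_five_mul_inner (e x : (EuclideanSpace ℝ (Fin 3))) : gradient (fun z : (EuclideanSpace ℝ (Fin 3)) => 5 * ⟪e, z⟫) x = (5 : ℝ) • e :=
  gradient_eq_of_hasFDerivAt_inner ((innerSL ℝ e).hasFDerivAt.const_mul 5) fun y => by
    simp [real_inner_smul_left]

/-- `∇(2‖·‖²) = 4 z`. [folklore] -/
theorem gradient_two_mul_norm_sq (x : (EuclideanSpace ℝ (Fin 3))) : gradient (fun z : (EuclideanSpace ℝ (Fin 3)) => 2 * ‖z‖ ^ 2) x = (4 : ℝ) • x :=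
  gradient_eq_of_hasFDerivAt_inner ((hasStrictFDerivAt_norm_sq x).hasFDerivAt.const_mul 2) fun y => by
    simp [real_inner_smul_left]; ring

/-- `∇(5⟪e,z⟫² − 10‖z‖²) = 10⟪e,z⟫ e − 20 z`. [folklore] -/
theorem gradient_headScalar (e x : (EuclideanSpace ℝ (Fin 3))) :
    gradient (fun z : (EuclideanSpace ℝ (Fin 3)) => 5 * (⟪e, z⟫ * ⟪e, z⟫) - 10 * ‖z‖ ^ 2) x = (10 * ⟪e, x⟫) • e - (20 : ℝ) • x := by
  have h0 : HasFDerivAt (fun z : (EuclideanSpace ℝ (Fin 3)) => ⟪e, z⟫) (innerSL ℝ e) x := (innerSL ℝ e).hasFDerivAt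
  refine gradient_eq_of_hasFDerivAt_inner (((h0.mul h0).const_mul 5).sub
    ((hasStrictFDerivAt_norm_sq x).hasFDerivAt.const_mul 10)) fun y => ?_
  simp [inner_sub_left, real_inner_smul_left]
  ring

/-- `∇(−⟪e,z⟫‖z‖²) = −(2⟪e,z⟫ z + ‖z‖² e)`. [folklore] -/
theorem gradient_momentScalar (e x : (EuclideanSpace ℝ (Fin 3))) :
    gradient (fun z : (EuclideanSpace ℝ (Fin 3)) => -(⟪e, z⟫ * ‖z‖ ^ 2)) x = -((2 * ⟪e, x⟫) • x + ‖x‖ ^ 2 • e) := by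
  have h0 : HasFDerivAt (fun z : (EuclideanSpace ℝ (Fin 3)) => ⟪e, z⟫) (innerSL ℝ e) x := (innerSL ℝ e).hasFDerivAt
  refine gradient_eq_of_hasFDerivAt_inner ((h0.mul (hasStrictFDerivAt_norm_sq x).hasFDerivAt).neg) fun y => ?_
  simp [inner_add_left, inner_neg_left, real_inner_smul_left]
  ring

/-- The Laplacian of a continuous linear map vanishes. [folklore] -/
theorem laplacian_clm_eq_zero {F : Type*} [NormedAddCommGroup F] [NormedSpace ℝ F] (l : (EuclideanSpace ℝ (Fin 3)) →L[ℝ] F) (x : (EuclideanSpace ℝ (Fin 3))) :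
    Laplacian.laplacian (⇑l) x = 0 := by
  rw [InnerProductSpace.laplacian_eq_iteratedFDeriv_orthonormalBasis (⇑l) (EuclideanSpace.basisFun (Fin 3) ℝ)]
  simp only [iteratedFDeriv_two_apply]
  have h : fderiv ℝ (⇑l) = fun _ => l := by funext y; exact l.fderiv
  rw [h]
  simp

/-- `Δ(5⟪e, ·⟫) = 0`. [folklore] -/
theorem laplacian_five_mul_inner (e x : (EuclideanSpace ℝ (Fin 3))) : Laplacian.laplacian (fun z : (EuclideanSpace ℝ (Fin 3)) => 5 * ⟪e, z⟫) x = 0 := by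
  have h : (fun z : (EuclideanSpace ℝ (Fin 3)) => 5 * ⟪e, z⟫) = ⇑((5 : ℝ) • innerSL ℝ e) := by
    funext z; simp
  rw [h]
  exact laplacian_clm_eq_zero _ x

/-! ### §2 The witness: Hill's core `v(z) = ⟪e,z⟫ z − 2‖z‖² e`, potential `T = 5⟪e,z⟫` -/

/-- Pointwise cross-product algebra used twice. [folklore] -/
theorem cross_smul_algebra (a b : ℝ) (e x : (EuclideanSpace ℝ (Fin 3))) :
    cross (a • e - b • x) x = a • cross e x ∧ cross (-(b • x + a • e)) ((5 : ℝ) • e) = (5 * b) • cross e x ∧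
      cross e x - cross ((4 : ℝ) • x) e = (5 : ℝ) • cross e x ∧ cross ((5 : ℝ) • e) x = (5 : ℝ) • cross e x := by
  refine ⟨?_, ?_, ?_, ?_⟩ <;> ext i <;> fin_cases i <;>
    simp [cross, cross_apply] <;> ring

/-- ★ `curl v = 5 e × z` for Hill's core `v(z) = ⟪e,z⟫ z − 2‖z‖² e`. [cite: Acheson1990, §5.5 (5.25) and Ex. 5.21; Hill1894 Art. 1] -/
theorem curl_hillCore (e x : (EuclideanSpace ℝ (Fin 3))) :
    curl (fun z : (EuclideanSpace ℝ (Fin 3)) => ⟪e, z⟫ • z - (2 * ‖z‖ ^ 2) • e) x = (5 : ℝ) • cross e x := by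
  have hs : DifferentiableAt ℝ (fun z : (EuclideanSpace ℝ (Fin 3)) => ⟪e, z⟫) x := (innerSL ℝ e).differentiableAt
  have hq : DifferentiableAt ℝ (fun z : (EuclideanSpace ℝ (Fin 3)) => 2 * ‖z‖ ^ 2) x :=
    ((hasStrictFDerivAt_norm_sq x).hasFDerivAt.const_mul 2).differentiableAt
  have h1 : DifferentiableAt ℝ (fun z : (EuclideanSpace ℝ (Fin 3)) => ⟪e, z⟫ • z) x := hs.smul differentiableAt_id
  have h2 : DifferentiableAt ℝ (fun z : (EuclideanSpace ℝ (Fin 3)) => (2 * ‖z‖ ^ 2) • e) x := hq.smul (differentiableAt_const e)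
  have hge : gradient (fun z : EuclideanSpace ℝ (Fin 3) => ⟪e, z⟫) x = e :=
    gradient_eq_of_hasFDerivAt_inner (innerSL ℝ e).hasFDerivAt fun y => by simp
  rw [curl_sub h1 h2, curl_smul_id_eq_cross_gradient hs, hge,
    curl_smul hq (differentiableAt_const e), curl_eq_zero_of_fderiv_eq_zero (fderiv_const_apply e),
    smul_zero, zero_add, fderiv_eq_innerSL_gradient, curlCLM_smulRight_innerSL, gradient_two_mul_norm_sq]
  exact (cross_smul_algebra 0 0 e x).2.2.1

/-- The head scalar `⟪v, ∇T⟫ = ⟪v(z), 5e⟫ = 5⟪e,z⟫² − 10‖z‖²` for a unit vector `e`. [folklore] -/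
theorem inner_hillCore_five_smul {e : (EuclideanSpace ℝ (Fin 3))} (he : ‖e‖ = 1) (z : (EuclideanSpace ℝ (Fin 3))) :
    ⟪⟪e, z⟫ • z - (2 * ‖z‖ ^ 2) • e, (5 : ℝ) • e⟫ = 5 * (⟪e, z⟫ * ⟪e, z⟫) - 10 * ‖z‖ ^ 2 := by
  have hee : ⟪e, e⟫ = (1 : ℝ) := by rw [real_inner_self_eq_norm_sq, he]; norm_num
  rw [inner_sub_left, real_inner_smul_left, real_inner_smul_left, real_inner_smul_right, real_inner_smul_right,
    real_inner_comm e z, hee]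
  ring

/-- The radial momentum `m = ⟪v(z), z⟫ = −⟪e,z⟫‖z‖²`. [folklore] -/
theorem inner_hillCore_self (e z : (EuclideanSpace ℝ (Fin 3))) :
    ⟪⟪e, z⟫ • z - (2 * ‖z‖ ^ 2) • e, z - 0⟫ = -(⟪e, z⟫ * ‖z‖ ^ 2) := by
  rw [sub_zero, inner_sub_left, real_inner_smul_left, real_inner_smul_left, real_inner_self_eq_norm_sq]
  ring

/-- ★ Left-hand side of (E1) for the witness: `∇(∂ₜT + ⟪v,∇T⟫ − ΔT) × z = 10⟪e,z⟫ • (e × z)`. [folklore] -/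
theorem hillCore_E1_lhs {e : (EuclideanSpace ℝ (Fin 3))} (he : ‖e‖ = 1) (t : ℝ) (x : (EuclideanSpace ℝ (Fin 3))) :
    cross (gradient (fun z : (EuclideanSpace ℝ (Fin 3)) => deriv (fun _ : ℝ => 5 * ⟪e, z⟫) t
        + ⟪⟪e, z⟫ • z - (2 * ‖z‖ ^ 2) • e, gradient (fun w : (EuclideanSpace ℝ (Fin 3)) => 5 * ⟪e, w⟫) z⟫
        - Laplacian.laplacian (fun w : (EuclideanSpace ℝ (Fin 3)) => 5 * ⟪e, w⟫) z) x) (x - 0) =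
      (10 * ⟪e, x⟫) • cross e x := by
  have hF : (fun z : (EuclideanSpace ℝ (Fin 3)) => deriv (fun _ : ℝ => 5 * ⟪e, z⟫) t
        + ⟪⟪e, z⟫ • z - (2 * ‖z‖ ^ 2) • e, gradient (fun w : (EuclideanSpace ℝ (Fin 3)) => 5 * ⟪e, w⟫) z⟫
        - Laplacian.laplacian (fun w : (EuclideanSpace ℝ (Fin 3)) => 5 * ⟪e, w⟫) z) =
      fun z : (EuclideanSpace ℝ (Fin 3)) => 5 * (⟪e, z⟫ * ⟪e, z⟫) - 10 * ‖z‖ ^ 2 := by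
    funext z
    rw [deriv_const, gradient_five_mul_inner, laplacian_five_mul_inner, inner_hillCore_five_smul he, zero_add, sub_zero]
  rw [hF, gradient_headScalar, sub_zero]
  exact (cross_smul_algebra (10 * ⟪e, x⟫) 20 e x).1

/-- ★ Right-hand side of (E1) for the witness: `∇⟪v, z⟫ × ∇T = 10⟪e,z⟫ • (e × z)`. [folklore] -/
theorem hillCore_E1_rhs (e : (EuclideanSpace ℝ (Fin 3))) (x : (EuclideanSpace ℝ (Fin 3))) :
    cross (gradient (fun z : (EuclideanSpace ℝ (Fin 3)) => ⟪⟪e, z⟫ • z - (2 * ‖z‖ ^ 2) • e, z - 0⟫) x)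
        (gradient (fun w : (EuclideanSpace ℝ (Fin 3)) => 5 * ⟪e, w⟫) x) = (10 * ⟪e, x⟫) • cross e x := by
  have hm : (fun z : (EuclideanSpace ℝ (Fin 3)) => ⟪⟪e, z⟫ • z - (2 * ‖z‖ ^ 2) • e, z - 0⟫) = fun z : (EuclideanSpace ℝ (Fin 3)) => -(⟪e, z⟫ * ‖z‖ ^ 2) := by
    funext z; exact inner_hillCore_self e z
  rw [hm, gradient_momentScalar, gradient_five_mul_inner]
  have h := (cross_smul_algebra (‖x‖ ^ 2) (2 * ⟪e, x⟫) e x).2.1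
  rw [h]
  congr 1
  ring

/-! ### §2b The witness is a classical solution of the vorticity formulation (steady Navier–Stokes vorticity equation) -/

/-- Coordinate algebra: `e × (a z − b e) = a (e × z)`, `⟪e, e × z⟫ = 0`, `⟪z, e × z⟫ = 0`. [folklore] -/
theorem cross_inner_algebra (a b : ℝ) (e x : (EuclideanSpace ℝ (Fin 3))) :
    cross e (a • x - b • e) = a • cross e x ∧ ⟪e, cross e x⟫ = 0 ∧ ⟪x, cross e x⟫ = 0 := by
  refine ⟨?_, ?_, ?_⟩
  · ext i; fin_cases i <;> simp [cross, cross_apply] <;> ring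
  · simp [cross, cross_apply, PiLp.inner_apply, Fin.sum_univ_three, -inner_self_eq_norm_sq_to_K]; ring
  · simp [cross, cross_apply, PiLp.inner_apply, Fin.sum_univ_three, -inner_self_eq_norm_sq_to_K]; ring

/-- The Fréchet derivative of Hill's core: `Dv(x) h = ⟪e,h⟫ x + ⟪e,x⟫ h − 4⟪x,h⟫ e`. [folklore] -/
theorem fderiv_hillCore_apply (e x h : (EuclideanSpace ℝ (Fin 3))) :
    fderiv ℝ (fun z : (EuclideanSpace ℝ (Fin 3)) => ⟪e, z⟫ • z - (2 * ‖z‖ ^ 2) • e) x h = ⟪e, h⟫ • x + ⟪e, x⟫ • h - (4 * ⟪x, h⟫) • e := by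
  have h0 : HasFDerivAt (fun z : (EuclideanSpace ℝ (Fin 3)) => ⟪e, z⟫) (innerSL ℝ e) x := (innerSL ℝ e).hasFDerivAt
  have hq : HasFDerivAt (fun z : (EuclideanSpace ℝ (Fin 3)) => 2 * ‖z‖ ^ 2) _ x := (hasStrictFDerivAt_norm_sq x).hasFDerivAt.const_mul 2
  have hv : HasFDerivAt (fun z : (EuclideanSpace ℝ (Fin 3)) => ⟪e, z⟫ • z - (2 * ‖z‖ ^ 2) • e) _ x :=
    (h0.fun_smul (hasFDerivAt_id x)).sub (hq.smul_const e)
  rw [hv.fderiv]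
  simp [two_smul, innerSL_apply_apply, ContinuousLinearMap.smulRight_apply]
  module

/-- ★ Hill's core is divergence free (coordinate-free form of `Literature…hill_core_div`). [cite: Hill1894, Art. 1; Acheson1990, §5.5] -/
theorem divergence_hillCore (e x : (EuclideanSpace ℝ (Fin 3))) :
    VectorCalculus.divergence (fun z : (EuclideanSpace ℝ (Fin 3)) => ⟪e, z⟫ • z - (2 * ‖z‖ ^ 2) • e) x = 0 := by
  rw [divergence_eq_sum_inner_fderiv (EuclideanSpace.basisFun (Fin 3) ℝ)]
  simp_rw [fderiv_hillCore_apply]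
  simp [Fin.sum_univ_three, EuclideanSpace.basisFun_apply, PiLp.inner_apply, -inner_self_eq_norm_sq_to_K]
  ring

/-- The vorticity slice of the (steady) witness is the linear field `5 e × z`. [folklore] -/
theorem vorticity_hillCore (e : (EuclideanSpace ℝ (Fin 3))) (t : ℝ) :
    vorticity (fun (_ : ℝ) (z : (EuclideanSpace ℝ (Fin 3))) => ⟪e, z⟫ • z - (2 * ‖z‖ ^ 2) • e) t = fun z : (EuclideanSpace ℝ (Fin 3)) => (5 : ℝ) • cross e z := by
  funext z
  rw [vorticity_apply]
  exact curl_hillCore e z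

/-- `z ↦ 5 e × z` is the continuous linear map `5 • crossCLM e`. [folklore] -/
theorem five_smul_cross_eq_clm (e : (EuclideanSpace ℝ (Fin 3))) : (fun z : (EuclideanSpace ℝ (Fin 3)) => (5 : ℝ) • cross e z) = ⇑((5 : ℝ) • crossCLM e) := by
  funext z; simp

/-- ★★ **Hill's core solves the vorticity formulation classically on `(−∞,0)` with `ν = 1`** (indeed with any `ν`: `Δω = 0`):
`∂ₜω + (v·∇)ω = (ω·∇)v + Δω` with `ω = 5 e × z`, both transport terms equal to `5⟪e,z⟫ (e × z)`, and `div v = 0`.  This is the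
steady vorticity equation of Hill's spherical-vortex core extended to all of `ℝ³` (an exact steady Euler AND Navier–Stokes flow, its
Laplacian `Δv = −10e` being a constant absorbed by the pressure). [cite: Hill1894, Art. 1 (i)–(ii); Acheson1990, §5.5 eq. (5.25)] -/
theorem isVorticitySolutionOn_hillCore (e : (EuclideanSpace ℝ (Fin 3))) :
    IsVorticitySolutionOn (Set.Iio 0) 1 (fun (_ : ℝ) (z : (EuclideanSpace ℝ (Fin 3))) => ⟪e, z⟫ • z - (2 * ‖z‖ ^ 2) • e) where
  smooth_velocity := by
    refine ContDiff.contDiffOn ?_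
    exact ((contDiff_const.inner ℝ contDiff_snd).smul contDiff_snd).sub
      ((contDiff_const.mul (contDiff_snd.norm_sq ℝ)).smul contDiff_const)
  vorticity_eq := by
    intro t _ x
    have hω := vorticity_hillCore e
    -- time derivative of the steady vorticity vanishes
    have h1 : timeDerivWithin (Set.Iio 0) (vorticity fun (_ : ℝ) (z : (EuclideanSpace ℝ (Fin 3))) => ⟪e, z⟫ • z - (2 * ‖z‖ ^ 2) • e) t x = 0 := by
      rw [timeDerivWithin_apply]
      simp
    -- (v·∇)ω
    have h2 : convect ((fun (_ : ℝ) (z : (EuclideanSpace ℝ (Fin 3))) => ⟪e, z⟫ • z - (2 * ‖z‖ ^ 2) • e) t)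
        (vorticity (fun (_ : ℝ) (z : (EuclideanSpace ℝ (Fin 3))) => ⟪e, z⟫ • z - (2 * ‖z‖ ^ 2) • e) t) x = (5 * ⟪e, x⟫) • cross e x := by
      rw [convect_apply, hω, five_smul_cross_eq_clm, ContinuousLinearMap.fderiv]
      rw [_root_.smul_apply, crossCLM_apply, (cross_inner_algebra ⟪e, x⟫ (2 * ‖x‖ ^ 2) e x).1, smul_smul]
    -- (ω·∇)v
    have h3 : convect (vorticity (fun (_ : ℝ) (z : (EuclideanSpace ℝ (Fin 3))) => ⟪e, z⟫ • z - (2 * ‖z‖ ^ 2) • e) t)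
        ((fun (_ : ℝ) (z : (EuclideanSpace ℝ (Fin 3))) => ⟪e, z⟫ • z - (2 * ‖z‖ ^ 2) • e) t) x = (5 * ⟪e, x⟫) • cross e x := by
      rw [convect_apply, hω]
      simp only [fderiv_hillCore_apply, real_inner_smul_right, (cross_inner_algebra 0 0 e x).2.1,
        (cross_inner_algebra 0 0 e x).2.2, mul_zero, zero_smul, zero_add, sub_zero, smul_smul, mul_comm ⟪e, x⟫ (5 : ℝ)]
    -- Δω = 0
    have h4 : Laplacian.laplacian (vorticity (fun (_ : ℝ) (z : (EuclideanSpace ℝ (Fin 3))) => ⟪e, z⟫ • z - (2 * ‖z‖ ^ 2) • e) t) x = 0 := by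
      rw [hω, five_smul_cross_eq_clm]
      exact laplacian_clm_eq_zero _ x
    rw [h1, h2, h3, h4, smul_zero, zero_add, add_zero]
  divFree := fun t _ x => divergence_hillCore e x

/-! ### §3 The tightness theorem -/

/-- ★★ **THE WALL IS FALSE WITHOUT ITS GROWTH HYPOTHESES.**  Dropping `IsBoundedAncientMildSolution 1 v` (hypothesis (1)) and the bound on
the toroidal potential (hypothesis (5)) from `StubScalarLiouville` — keeping measurable slices, joint smoothness of `v` and of `T` off the
centre, the representation `curl v = ∇T × (x − x₀)` and the evolution law (E1) verbatim — leaves a FALSE statement: Hill's spherical-vortex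
core `v(z) = ⟪e,z⟫ z − 2‖z‖² e`, `T = 5⟪e,z⟫`, `x₀ = 0` (a steady, hence ancient, unthreaded smooth flow, unbounded like `‖z‖²`) satisfies all
of them with `∇T × z = 5 e × z ≢ 0`.  Any proof of the wall must therefore use the boundedness of `v` or of `T`.
[cite: Hill1894, Art. 1; Acheson1990, §5.5 eq. (5.25); KochNadirashviliSereginSverak2009, Thm 5.2] -/
theorem stubScalarLiouville_false_without_bounds :
    ¬ (∀ (v : ℝ → EuclideanSpace ℝ (Fin 3) → EuclideanSpace ℝ (Fin 3)) (x₀ : EuclideanSpace ℝ (Fin 3))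
        (T : ℝ → EuclideanSpace ℝ (Fin 3) → ℝ),
        (∀ t < 0, AEStronglyMeasurable (v t) volume) →
        ContDiffOn ℝ (⊤ : ℕ∞) (Function.uncurry v) (Set.Iio 0 ×ˢ Set.univ) →
        ContDiffOn ℝ (⊤ : ℕ∞) (Function.uncurry T) (Set.Iio 0 ×ˢ ({x₀}ᶜ : Set (EuclideanSpace ℝ (Fin 3)))) →
        (∀ t < 0, ∀ x, Literature.Analysis.FluidPDE.curl (v t) x =
          Literature.Analysis.FluidPDE.cross (gradient (T t) x) (x - x₀)) →
        (∀ t < 0, ∀ x, x ≠ x₀ →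
          Literature.Analysis.FluidPDE.cross
              (gradient (fun z => deriv (fun s => T s z) t + inner ℝ (v t z) (gradient (T t) z)
                - Laplacian.laplacian (T t) z) x) (x - x₀) =
            Literature.Analysis.FluidPDE.cross (gradient (fun z => inner ℝ (v t z) (z - x₀)) x) (gradient (T t) x)) →
        ∀ t < 0, ∀ x, Literature.Analysis.FluidPDE.cross (gradient (T t) x) (x - x₀) = 0) := by
  intro h
  -- the unit vector `e = e₃` and the test point `x = e₁`
  set e : (EuclideanSpace ℝ (Fin 3)) := EuclideanSpace.single 2 (1 : ℝ) with he_def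
  have he : ‖e‖ = 1 := by simp [he_def]
  have hmain := h (fun _ z => ⟪e, z⟫ • z - (2 * ‖z‖ ^ 2) • e) 0 (fun _ z => 5 * ⟪e, z⟫)
    (fun t _ => (Continuous.aestronglyMeasurable (by fun_prop)))
    (by
      refine ContDiff.contDiffOn ?_
      have h1 : ContDiff ℝ (⊤ : ℕ∞) (fun p : ℝ × (EuclideanSpace ℝ (Fin 3)) => ⟪e, p.2⟫ • p.2 - (2 * ‖p.2‖ ^ 2) • e) :=
        ((contDiff_const.inner ℝ contDiff_snd).smul contDiff_snd).sub
          ((contDiff_const.mul (contDiff_snd.norm_sq ℝ)).smul contDiff_const)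
      exact h1)
    (by
      refine ContDiff.contDiffOn ?_
      have h1 : ContDiff ℝ (⊤ : ℕ∞) (fun p : ℝ × (EuclideanSpace ℝ (Fin 3)) => 5 * ⟪e, p.2⟫) := contDiff_const.mul (contDiff_const.inner ℝ contDiff_snd)
      exact h1)
    (fun t _ x => by rw [sub_zero, curl_hillCore, gradient_five_mul_inner]; exact ((cross_smul_algebra 0 0 e x).2.2.2).symm)
    (fun t _ x _ => by rw [hillCore_E1_lhs he, hillCore_E1_rhs])
  -- evaluate the (false) conclusion at `t = −1`, `x = e₁`, coordinate `1`
  have h0 := hmain (-1) (by norm_num) (EuclideanSpace.single 0 (1 : ℝ))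
  rw [sub_zero, gradient_five_mul_inner] at h0
  have h1 := congrArg (fun w : (EuclideanSpace ℝ (Fin 3)) => w 1) h0
  simp [he_def, cross, cross_apply] at h1

/-- ★★★ **THE WALL IS FALSE WITHOUT ITS GROWTH HYPOTHESES, EVEN FOR CLASSICAL ANCIENT NAVIER–STOKES FLOWS.**  In `StubScalarLiouville`
replace hypothesis (1) `IsBoundedAncientMildSolution 1 v` by the classical vorticity formulation `IsVorticitySolutionOn (−∞,0) 1 v` (exactly
what the bridge stub `stub_vorticityOfClass` extracts from (1), minus its curl bound) and drop the bound (5) on `T`, keeping (2), (3), (4), (6),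
(7) verbatim: the resulting statement is FALSE, refuted by Hill's spherical-vortex core (`isVorticitySolutionOn_hillCore`, `curl_hillCore`,
`hillCore_E1_lhs/rhs`).  Hence the two boundedness hypotheses are the load-bearing ones: the representation + evolution law + smoothness +
the Navier–Stokes vorticity equation on the whole past do not force `∇T × (x − x₀) ≡ 0`.
[cite: Hill1894, Art. 1; Acheson1990, §5.5 eq. (5.25); KochNadirashviliSereginSverak2009, Thm 5.2 (arXiv:0709.3599 p. 11)] -/
theorem stubScalarLiouville_false_without_bounds_vorticityClass :
    ¬ (∀ (v : ℝ → EuclideanSpace ℝ (Fin 3) → EuclideanSpace ℝ (Fin 3)) (x₀ : EuclideanSpace ℝ (Fin 3))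
        (T : ℝ → EuclideanSpace ℝ (Fin 3) → ℝ),
        Literature.Analysis.FluidPDE.IsVorticitySolutionOn (Set.Iio 0) 1 v →
        (∀ t < 0, AEStronglyMeasurable (v t) volume) →
        ContDiffOn ℝ (⊤ : ℕ∞) (Function.uncurry v) (Set.Iio 0 ×ˢ Set.univ) →
        ContDiffOn ℝ (⊤ : ℕ∞) (Function.uncurry T) (Set.Iio 0 ×ˢ ({x₀}ᶜ : Set (EuclideanSpace ℝ (Fin 3)))) →
        (∀ t < 0, ∀ x, Literature.Analysis.FluidPDE.curl (v t) x =
          Literature.Analysis.FluidPDE.cross (gradient (T t) x) (x - x₀)) →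
        (∀ t < 0, ∀ x, x ≠ x₀ →
          Literature.Analysis.FluidPDE.cross
              (gradient (fun z => deriv (fun s => T s z) t + inner ℝ (v t z) (gradient (T t) z)
                - Laplacian.laplacian (T t) z) x) (x - x₀) =
            Literature.Analysis.FluidPDE.cross (gradient (fun z => inner ℝ (v t z) (z - x₀)) x) (gradient (T t) x)) →
        ∀ t < 0, ∀ x, Literature.Analysis.FluidPDE.cross (gradient (T t) x) (x - x₀) = 0) := by
  intro h
  set e : (EuclideanSpace ℝ (Fin 3)) := EuclideanSpace.single 2 (1 : ℝ) with he_def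
  have he : ‖e‖ = 1 := by simp [he_def]
  have hmain := h (fun _ z => ⟪e, z⟫ • z - (2 * ‖z‖ ^ 2) • e) 0 (fun _ z => 5 * ⟪e, z⟫)
    (isVorticitySolutionOn_hillCore e)
    (fun t _ => (Continuous.aestronglyMeasurable (by fun_prop)))
    (isVorticitySolutionOn_hillCore e).smooth_velocity
    (by
      refine ContDiff.contDiffOn ?_
      have h1 : ContDiff ℝ (⊤ : ℕ∞) (fun p : ℝ × (EuclideanSpace ℝ (Fin 3)) => 5 * ⟪e, p.2⟫) := contDiff_const.mul (contDiff_const.inner ℝ contDiff_snd)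
      exact h1)
    (fun t _ x => by rw [sub_zero, curl_hillCore, gradient_five_mul_inner]; exact ((cross_smul_algebra 0 0 e x).2.2.2).symm)
    (fun t _ x _ => by rw [hillCore_E1_lhs he, hillCore_E1_rhs])
  have h0 := hmain (-1) (by norm_num) (EuclideanSpace.single 0 (1 : ℝ))
  rw [sub_zero, gradient_five_mul_inner] at h0
  have h1 := congrArg (fun w : (EuclideanSpace ℝ (Fin 3)) => w 1) h0
  simp [he_def, cross, cross_apply] at h1

/-! ### §4 (APPEND v2) The same witness at the level of the crux's own shape -/

/-- Hill's core is unthreaded about the origin: `⟪z, curl v(z)⟫ = 0`. [folklore] -/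
theorem inner_self_curl_hillCore (e z : EuclideanSpace ℝ (Fin 3)) :
    ⟪z - 0, curl (fun w : EuclideanSpace ℝ (Fin 3) => ⟪e, w⟫ • w - (2 * ‖w‖ ^ 2) • e) z⟫ = 0 := by
  rw [sub_zero, curl_hillCore, real_inner_smul_right, (cross_inner_algebra 0 0 e z).2.2, mul_zero]

/-- ★★★ **THE CRUX'S SHAPE IS FALSE WITHOUT BOUNDEDNESS.**  The route statement `PoloidalLiouville` reads: `IsBoundedAncientMildSolution 1 v`,
measurable slices, joint smoothness on the past slab, vorticity tangent to the spheres about one centre ⟹ every slice is constant.  Replacing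
the first hypothesis by the classical vorticity formulation `IsVorticitySolutionOn (−∞,0) 1 v` (classical ancient Navier–Stokes in vorticity
form, NO growth condition) gives a FALSE statement: Hill's spherical-vortex core `v(z) = ⟪e,z⟫ z − 2‖z‖² e` is such a flow, unthreaded about
`0` (`inner_self_curl_hillCore`), and its slices are not constant (`v(0) = 0 ≠ v(e) = −e`).  So in the crux, as in the wall, BOUNDEDNESS is
the load-bearing hypothesis; unthreadedness + smoothness + the equations on the whole past do not suffice.
[cite: Hill1894, Art. 1; Acheson1990, §5.5 eq. (5.25); KochNadirashviliSereginSverak2009, Thm 5.2 (arXiv:0709.3599 p. 11)] -/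
theorem poloidalLiouville_shape_false_without_bounds :
    ¬ (∀ v : ℝ → EuclideanSpace ℝ (Fin 3) → EuclideanSpace ℝ (Fin 3),
        Literature.Analysis.FluidPDE.IsVorticitySolutionOn (Set.Iio 0) 1 v →
        (∀ t < 0, AEStronglyMeasurable (v t) volume) →
        ContDiffOn ℝ (⊤ : ℕ∞) (Function.uncurry v) (Set.Iio 0 ×ˢ Set.univ) →
        (∃ x₀ : EuclideanSpace ℝ (Fin 3), ∀ t < 0, ∀ x,
          inner ℝ (x - x₀) (Literature.Analysis.FluidPDE.curl (v t) x) = 0) →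
        ∀ t < 0, ∃ b : EuclideanSpace ℝ (Fin 3), ∀ x, v t x = b) := by
  intro h
  set e : EuclideanSpace ℝ (Fin 3) := EuclideanSpace.single 2 (1 : ℝ) with he_def
  have he : ‖e‖ = 1 := by simp [he_def]
  obtain ⟨b, hb⟩ := h (fun _ z => ⟪e, z⟫ • z - (2 * ‖z‖ ^ 2) • e) (isVorticitySolutionOn_hillCore e)
    (fun t _ => (Continuous.aestronglyMeasurable (by fun_prop))) (isVorticitySolutionOn_hillCore e).smooth_velocity
    ⟨0, fun t _ x => inner_self_curl_hillCore e x⟩ (-1) (by norm_num)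
  have h0 := hb 0
  have h1 := hb e
  simp only [inner_zero_right, zero_smul, norm_zero] at h0
  rw [← h0, real_inner_self_eq_norm_sq, he] at h1
  have h2 := congrArg (fun w : EuclideanSpace ℝ (Fin 3) => w 2) h1
  norm_num [he_def] at h2

end Summit.NavierStokesRegularity.NavierStokesRegularity.Theorems.PoloidalLiouville.Antidynamo

end
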